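import Mathlib
import HarnessLib
import Summits.HubbardSuperconductivity.HubbardSuperconductivity.Theorems.KLProgrammeC4aCausticWindowDispatch

/-!
# Route `KLProgramme` — crux C4a, S3 brick (B4) «(B4)-UMK1», «(M4)-TILING»: the third window type (CAUSTIC-FREE: `|δ₀| ≥ d₁ ≥ lo` ⟹ the laws are bounded) and the
# summation of per-window bounds over a tiling of the ϑ-circle — with `…CausticWindowDispatch(Transversal/PartnerBand)` every window of the (U1) ϑ-layer is ONE call and
# the circle bound is `⌈2π/ω⌉ · max(window bounds)`

Cell `gate-hubbard-kl`, seat hubbard-kl-k3c3-p3 (g29; row «implicit-function / monotonicity route for μ(n)»).  Located brick for the (C)-closer lane hubbard-kl-c4a-1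
(stub (C) `stub_twoLeg_curvature` of `KLRegimeEngineV17F2`, stmt-HubbardSuperconductivity-20437), memo HOME/hubbard-kl-k3c3-p3/U1-CAUSTIC-SUP.md §8 (M4).
* §1 **`intervalIntegral_caustic_free_le`**: on a window where `d₁ ≤ |m ϑ|` (`lo ≤ d₁`), `F ≥ 0`, and the two laws of the dispatcher hold where `m > 0` / `m < 0` (points of
  `Ioo α β`): `∫_α^β F ≤ ((A + P)·(√d₁)⁻¹ + B)·(β − α)` — no convexity, no separation needed away from the caustic;
* §2 **`intervalIntegral_le_card_mul_of_tiling`**: `∫_a^{a + Nω} F ≤ N·b` when each tile `[a + kω, a + (k+1)ω]` has `∫ ≤ b` (`intervalIntegral.sum_integral_adjacent_intervals`);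
  `intervalIntegral_le_card_mul_of_tiling_of_integrable` (one integrability hypothesis on the whole range).
So, per base angle `θ` and radius `ρ`: tile `[0, 2π]` by `N = ⌈2π/ω⌉` windows of an `n`-free length `ω` fixed by the geometry budgets; each window is caustic-free (§1),
transversal (`…DispatchTransversal`) or convex near an antipodal-umklapp configuration (`…DispatchPartnerBand`); the circle integral is `≤ N·max` — `n`-free and θ-uniform.
Pure real analysis; nothing about the model; nothing asserts (C), K3 or superconductivity.
References: Salmhofer 1999 §4.5.3 [cite: Salmhofer1999]; FST II CPAM 51 (1998) §3 [cite: FeldmanSalmhoferTrubowitz1998].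
-/

noncomputable section

namespace Summit.HubbardSuperconductivity.HubbardSuperconductivity.Theorems.C4a

set_option linter.dupNamespace false -- summit = problem name (single-conjunct summit), D-0017

open Real Set MeasureTheory intervalIntegral
open scoped Interval

/-! ## §1 The caustic-free window -/

/-- **THE CAUSTIC-FREE WINDOW.**  `α ≤ β`, `0 < lo ≤ d₁`, `A, P, B ≥ 0`; `F ≥ 0` on `[α,β]`; on `Ioo α β` the offset stays away from zero, `d₁ ≤ |m ϑ|`, and the pre law
`F ≤ A·lo·(max |m| lo)⁻¹(√(max |m| lo))⁻¹ + B` holds where `m > 0`, the post law `F ≤ P·(√|m|)⁻¹ + B` where `m < 0`.  THEN `∫_α^β F ≤ ((A + P)(√d₁)⁻¹ + B)(β − α)`. -/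
theorem intervalIntegral_caustic_free_le {F m : ℝ → ℝ} {α β d₁ lo A P B : ℝ} (hαβ : α ≤ β) (hlo : 0 < lo) (hd : lo ≤ d₁)
    (hA : 0 ≤ A) (hP : 0 ≤ P) (hB : 0 ≤ B) (hF0 : ∀ ϑ ∈ Icc α β, 0 ≤ F ϑ)
    (hm : ∀ ϑ ∈ Ioo α β, d₁ ≤ |m ϑ|)
    (hpre : ∀ ϑ ∈ Ioo α β, 0 < m ϑ → F ϑ ≤ A * (lo * ((max |m ϑ| lo)⁻¹ * (Real.sqrt (max |m ϑ| lo))⁻¹)) + B)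
    (hpost : ∀ ϑ ∈ Ioo α β, m ϑ < 0 → F ϑ ≤ P * (Real.sqrt |m ϑ|)⁻¹ + B) :
    ∫ ϑ in α..β, F ϑ ≤ ((A + P) * (Real.sqrt d₁)⁻¹ + B) * (β - α) := by
  have hd₁ : 0 < d₁ := lt_of_lt_of_le hlo hd
  have hsd : 0 < Real.sqrt d₁ := Real.sqrt_pos.2 hd₁
  have hC0 : 0 ≤ (A + P) * (Real.sqrt d₁)⁻¹ + B := by positivity
  -- pointwise bound on the open window
  have hpt : ∀ ϑ ∈ Ioo α β, F ϑ ≤ (A + P) * (Real.sqrt d₁)⁻¹ + B := fun ϑ hϑ => by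
    have hmϑ := hm ϑ hϑ
    have hmpos : 0 < |m ϑ| := lt_of_lt_of_le hd₁ hmϑ
    have hsq : (Real.sqrt |m ϑ|)⁻¹ ≤ (Real.sqrt d₁)⁻¹ := inv_anti₀ hsd (Real.sqrt_le_sqrt hmϑ)
    rcases lt_trichotomy (m ϑ) 0 with hneg | hz | hpos
    · have h1 := hpost ϑ hϑ hneg
      have h2 : P * (Real.sqrt |m ϑ|)⁻¹ ≤ (A + P) * (Real.sqrt d₁)⁻¹ := by
        calc P * (Real.sqrt |m ϑ|)⁻¹ ≤ P * (Real.sqrt d₁)⁻¹ := mul_le_mul_of_nonneg_left hsq hP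
          _ ≤ (A + P) * (Real.sqrt d₁)⁻¹ := mul_le_mul_of_nonneg_right (by linarith) (inv_nonneg.2 hsd.le)
      linarith
    · exact absurd hz (abs_pos.1 hmpos)
    · have h1 := hpre ϑ hϑ hpos
      have hmax : max |m ϑ| lo = |m ϑ| := max_eq_left (hd.trans hmϑ)
      rw [hmax] at h1
      -- `lo·|m|⁻¹·(√|m|)⁻¹ ≤ (√d₁)⁻¹`
      have h3 : lo * ((|m ϑ|)⁻¹ * (Real.sqrt |m ϑ|)⁻¹) ≤ (Real.sqrt d₁)⁻¹ := by
        have h4 : lo * (|m ϑ|)⁻¹ ≤ 1 := by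
          rw [← div_eq_mul_inv, div_le_one hmpos]; exact hd.trans hmϑ
        have h5 : 0 ≤ (Real.sqrt |m ϑ|)⁻¹ := inv_nonneg.2 (Real.sqrt_nonneg _)
        calc lo * ((|m ϑ|)⁻¹ * (Real.sqrt |m ϑ|)⁻¹) = lo * (|m ϑ|)⁻¹ * (Real.sqrt |m ϑ|)⁻¹ := by ring
          _ ≤ 1 * (Real.sqrt |m ϑ|)⁻¹ := mul_le_mul_of_nonneg_right h4 h5
          _ ≤ (Real.sqrt d₁)⁻¹ := by rw [one_mul]; exact hsq
      have h2 : A * (lo * ((|m ϑ|)⁻¹ * (Real.sqrt |m ϑ|)⁻¹)) ≤ (A + P) * (Real.sqrt d₁)⁻¹ := by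
        calc A * (lo * ((|m ϑ|)⁻¹ * (Real.sqrt |m ϑ|)⁻¹)) ≤ A * (Real.sqrt d₁)⁻¹ := mul_le_mul_of_nonneg_left h3 hA
          _ ≤ (A + P) * (Real.sqrt d₁)⁻¹ := mul_le_mul_of_nonneg_right (by linarith) (inv_nonneg.2 hsd.le)
      linarith
  -- almost everywhere on `Ι α β` (the right endpoint is null)
  have hae : ∀ᵐ ϑ, ϑ ∈ Ι α β → ‖F ϑ‖ ≤ (A + P) * (Real.sqrt d₁)⁻¹ + B := by
    have hβ : ({β}ᶜ : Set ℝ) ∈ ae (volume : Measure ℝ) := compl_mem_ae_iff.2 (measure_singleton β)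
    filter_upwards [hβ] with ϑ hϑ hI
    rw [uIoc_of_le hαβ] at hI
    have hne : ϑ ≠ β := hϑ
    have hO : ϑ ∈ Ioo α β := ⟨hI.1, lt_of_le_of_ne hI.2 hne⟩
    rw [Real.norm_eq_abs, abs_of_nonneg (hF0 ϑ ⟨hI.1.le, hI.2⟩)]
    exact hpt ϑ hO
  have h := intervalIntegral.norm_integral_le_of_norm_le_const_ae hae
  rw [Real.norm_eq_abs, abs_of_nonneg (sub_nonneg.2 hαβ)] at h
  exact (le_abs_self _).trans h

/-! ## §2 Summation over a tiling -/

/-- **TILING**: if each tile `[a + kω, a + (k+1)ω]`, `k < N`, carries `∫ F ≤ b` (and `F` is interval-integrable on it), then `∫_a^{a+Nω} F ≤ N·b`. -/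
theorem intervalIntegral_le_card_mul_of_tiling {F : ℝ → ℝ} {a ω b : ℝ} {N : ℕ}
    (hint : ∀ k : ℕ, k < N → IntervalIntegrable F volume (a + k * ω) (a + (k + 1 : ℕ) * ω))
    (hb : ∀ k : ℕ, k < N → ∫ ϑ in (a + k * ω)..(a + (k + 1 : ℕ) * ω), F ϑ ≤ b) :
    ∫ ϑ in a..(a + N * ω), F ϑ ≤ N * b := by
  have h := intervalIntegral.sum_integral_adjacent_intervals (a := fun k : ℕ => a + k * ω) (f := F) (μ := volume) (n := N)
    (fun k hk => hint k hk)
  simp only [Nat.cast_zero, zero_mul, add_zero] at h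
  rw [← h]
  calc ∑ k ∈ Finset.range N, ∫ ϑ in (a + k * ω)..(a + ((k + 1 : ℕ) : ℝ) * ω), F ϑ ≤ ∑ _k ∈ Finset.range N, b :=
        Finset.sum_le_sum fun k hk => hb k (Finset.mem_range.1 hk)
    _ = N * b := by rw [Finset.sum_const, Finset.card_range, nsmul_eq_mul]

/-- **TILING, one integrability hypothesis**: `0 ≤ ω`, `F` interval-integrable on `[a, a + Nω]`, each tile `∫ ≤ b` ⟹ `∫_a^{a+Nω} F ≤ N·b`. -/
theorem intervalIntegral_le_card_mul_of_tiling_of_integrable {F : ℝ → ℝ} {a ω b : ℝ} {N : ℕ} (hω : 0 ≤ ω)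
    (hint : IntervalIntegrable F volume a (a + N * ω))
    (hb : ∀ k : ℕ, k < N → ∫ ϑ in (a + k * ω)..(a + (k + 1 : ℕ) * ω), F ϑ ≤ b) :
    ∫ ϑ in a..(a + N * ω), F ϑ ≤ N * b := by
  refine intervalIntegral_le_card_mul_of_tiling (fun k hk => hint.mono_set ?_) hb
  have hk1 : ((k + 1 : ℕ) : ℝ) ≤ N := by exact_mod_cast hk
  have h0 : a ≤ a + k * ω := le_add_of_nonneg_right (by positivity)
  have h1 : a + k * ω ≤ a + ((k + 1 : ℕ) : ℝ) * ω := by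
    have : (k : ℝ) * ω ≤ ((k + 1 : ℕ) : ℝ) * ω := mul_le_mul_of_nonneg_right (by push_cast; linarith) hω
    linarith
  have h2 : a + ((k + 1 : ℕ) : ℝ) * ω ≤ a + N * ω := by
    have : ((k + 1 : ℕ) : ℝ) * ω ≤ (N : ℝ) * ω := mul_le_mul_of_nonneg_right hk1 hω
    linarith
  have hN : a ≤ a + N * ω := le_add_of_nonneg_right (by positivity)
  rw [uIcc_of_le h1, uIcc_of_le hN]
  exact Icc_subset_Icc h0 h2

end Summit.HubbardSuperconductivity.HubbardSuperconductivity.Theorems.C4a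

end
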